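import Summits.ResolutionOfSingularities.ResolutionOfSingularities.Theses.HomologicalConductor

/-!
# `StrictDrop` (crux stmt-ResolutionOfSingularities-16485): Hahn-series and polynomial lemmas for
# the `IsFractionRing` witness (negative-side support; see `FalseWithoutIsFractionRing.lean`)

The field is `K = 𝔽₂((t^ℚ))` (Hahn series), `t = single 1 1`, `v` its order valuation. Recorded
here, sorry-free: the value of a polynomial in `t` is non-negative and is `0` iff the constant term
is non-zero (`val_aeval_nonneg`, `val_aeval_eq_zero_of_coeff`), hence `v(P(t)) ≥ j ⇒ X^j ∣ P`
(`X_pow_dvd_of_le_val`) and the cancellation `z · G(t) = F(t), v(z) ≥ 0 ⇒ z = F₁(t)/G₁(t)` with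
`G₁(t)` a `v`-unit (`cancel`); and the Frobenius representation of the elements of the perfect
closure `𝔽₂(t^{1/2^∞}) ⊂ K` (`rep`: `y^(2^E) · G(t) = F(t)`).
-/

noncomputable section
open Polynomial

-- single-problem summit: the doubled namespace component `ResolutionOfSingularities` is forced
set_option linter.dupNamespace false

namespace Summit.ResolutionOfSingularities.ResolutionOfSingularities.Theorems.StrictDrop.Negative



/-- `v(t) = 1`. [folklore] -/
theorem v_T : (HahnSeries.addVal ℚ (ZMod 2)) (HahnSeries.single (1 : ℚ) (1 : ZMod 2) : HahnSeries ℚ (ZMod 2)) = 1 := by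
  rw [HahnSeries.addVal_apply, HahnSeries.orderTop_single one_ne_zero]; rfl

/-- `t ≠ 0`. [folklore] -/
theorem T_ne_zero : (HahnSeries.single (1 : ℚ) (1 : ZMod 2) : HahnSeries ℚ (ZMod 2)) ≠ 0 := HahnSeries.single_ne_zero one_ne_zero

/-- Every polynomial in `t` has non-negative value. [folklore] -/
theorem val_aeval_nonneg (P : (ZMod 2)[X]) : 0 ≤ (HahnSeries.addVal ℚ (ZMod 2)) (aeval (HahnSeries.single (1 : ℚ) (1 : ZMod 2) : HahnSeries ℚ (ZMod 2)) P) := by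
  induction P using Polynomial.induction_on' with
  | add p q hp hq =>
    rw [map_add]
    exact le_trans (le_min hp hq) (AddValuation.map_add _ _ _)
  | monomial n c =>
    rw [aeval_monomial, AddValuation.map_mul, AddValuation.map_pow, v_T]
    rcases (by decide : ∀ c : ZMod 2, c = 0 ∨ c = 1) c with rfl | rfl
    · simp
    · rw [map_one, AddValuation.map_one, zero_add]
      exact nsmul_nonneg zero_le_one n

/-- A polynomial with non-zero constant term is a unit of the valuation ring at `t`. [folklore] -/
theorem val_aeval_eq_zero_of_coeff {P : (ZMod 2)[X]} (h : P.coeff 0 ≠ 0) : (HahnSeries.addVal ℚ (ZMod 2)) (aeval (HahnSeries.single (1 : ℚ) (1 : ZMod 2) : HahnSeries ℚ (ZMod 2)) P) = 0 := by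
  have h1 : P.coeff 0 = 1 := by
    rcases (by decide : ∀ c : ZMod 2, c = 0 ∨ c = 1) (P.coeff 0) with h0 | h0 <;> simp_all
  have hP : aeval (HahnSeries.single (1 : ℚ) (1 : ZMod 2) : HahnSeries ℚ (ZMod 2)) P = aeval (HahnSeries.single (1 : ℚ) (1 : ZMod 2) : HahnSeries ℚ (ZMod 2)) (divX P) * (HahnSeries.single (1 : ℚ) (1 : ZMod 2) : HahnSeries ℚ (ZMod 2)) + 1 := by
    conv_lhs => rw [← divX_mul_X_add P]
    rw [map_add, map_mul, aeval_X, aeval_C, h1, (algebraMap (ZMod 2) (HahnSeries ℚ (ZMod 2))).map_one]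
  rw [hP]
  have hlt : (HahnSeries.addVal ℚ (ZMod 2)) (1 : (HahnSeries ℚ (ZMod 2))) < (HahnSeries.addVal ℚ (ZMod 2)) (aeval (HahnSeries.single (1 : ℚ) (1 : ZMod 2) : HahnSeries ℚ (ZMod 2)) (divX P) * (HahnSeries.single (1 : ℚ) (1 : ZMod 2) : HahnSeries ℚ (ZMod 2))) := by
    rw [AddValuation.map_one, AddValuation.map_mul, v_T]
    exact lt_of_lt_of_le (by exact_mod_cast zero_lt_one) (le_add_of_nonneg_left (val_aeval_nonneg _))
  rw [AddValuation.map_add_eq_of_lt_right _ hlt, AddValuation.map_one]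

/-- `v(P(t)) ≥ j ⇒ X^j ∣ P`. [folklore] -/
theorem X_pow_dvd_of_le_val (j : ℕ) : ∀ P : (ZMod 2)[X], (j : WithTop ℚ) ≤ (HahnSeries.addVal ℚ (ZMod 2)) (aeval (HahnSeries.single (1 : ℚ) (1 : ZMod 2) : HahnSeries ℚ (ZMod 2)) P) → X ^ j ∣ P := by
  induction j with
  | zero => intro P _; simp
  | succ j ih =>
    intro P h
    have h0 : P.coeff 0 = 0 := by
      by_contra hne
      rw [val_aeval_eq_zero_of_coeff hne] at h
      have : (0 : WithTop ℚ) < ((j + 1 : ℕ) : WithTop ℚ) := by exact_mod_cast Nat.succ_pos j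
      exact absurd (lt_of_lt_of_le this h) (lt_irrefl _)
    have hP : P = divX P * X := by
      conv_lhs => rw [← divX_mul_X_add P]
      simp [h0]
    have hval : (HahnSeries.addVal ℚ (ZMod 2)) (aeval (HahnSeries.single (1 : ℚ) (1 : ZMod 2) : HahnSeries ℚ (ZMod 2)) P) = (HahnSeries.addVal ℚ (ZMod 2)) (aeval (HahnSeries.single (1 : ℚ) (1 : ZMod 2) : HahnSeries ℚ (ZMod 2)) (divX P)) + 1 := by
      conv_lhs => rw [hP]
      rw [map_mul, aeval_X, AddValuation.map_mul, v_T]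
    rw [hval] at h
    have h' : (j : WithTop ℚ) ≤ (HahnSeries.addVal ℚ (ZMod 2)) (aeval (HahnSeries.single (1 : ℚ) (1 : ZMod 2) : HahnSeries ℚ (ZMod 2)) (divX P)) := by
      have hc : ((j + 1 : ℕ) : WithTop ℚ) = (j : WithTop ℚ) + 1 := by push_cast; rfl
      rw [hc] at h
      exact (WithTop.add_le_add_iff_right WithTop.one_ne_top).mp h
    obtain ⟨Q, hQ⟩ := ih (divX P) h'
    refine ⟨Q, ?_⟩
    rw [hP, hQ, pow_succ]; ring

/-- Cancellation: a `z` of non-negative value with `z · G(t) = F(t)` is `F₁(t) / G₁(t)` with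
`G₁(t)` a unit of the valuation ring. [folklore] -/
theorem cancel {z : (HahnSeries ℚ (ZMod 2))} (hz : 0 ≤ (HahnSeries.addVal ℚ (ZMod 2)) z) {F G : (ZMod 2)[X]} (hG : aeval (HahnSeries.single (1 : ℚ) (1 : ZMod 2) : HahnSeries ℚ (ZMod 2)) G ≠ 0)
    (h : z * aeval (HahnSeries.single (1 : ℚ) (1 : ZMod 2) : HahnSeries ℚ (ZMod 2)) G = aeval (HahnSeries.single (1 : ℚ) (1 : ZMod 2) : HahnSeries ℚ (ZMod 2)) F) :
    ∃ F₁ G₁ : (ZMod 2)[X], (HahnSeries.addVal ℚ (ZMod 2)) (aeval (HahnSeries.single (1 : ℚ) (1 : ZMod 2) : HahnSeries ℚ (ZMod 2)) G₁) = 0 ∧ aeval (HahnSeries.single (1 : ℚ) (1 : ZMod 2) : HahnSeries ℚ (ZMod 2)) G₁ ≠ 0 ∧ z * aeval (HahnSeries.single (1 : ℚ) (1 : ZMod 2) : HahnSeries ℚ (ZMod 2)) G₁ = aeval (HahnSeries.single (1 : ℚ) (1 : ZMod 2) : HahnSeries ℚ (ZMod 2)) F₁ := by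
  have hG0 : G ≠ 0 := by rintro rfl; exact hG (map_zero _)
  obtain ⟨G₁, hGeq, hndvd⟩ := exists_eq_pow_rootMultiplicity_mul_and_not_dvd G hG0 0
  simp only [map_zero, sub_zero] at hGeq hndvd
  set j := G.rootMultiplicity 0
  have hG₁c : G₁.coeff 0 ≠ 0 := fun h0 => hndvd (X_dvd_iff.mpr h0)
  have hvG₁ : (HahnSeries.addVal ℚ (ZMod 2)) (aeval (HahnSeries.single (1 : ℚ) (1 : ZMod 2) : HahnSeries ℚ (ZMod 2)) G₁) = 0 := val_aeval_eq_zero_of_coeff hG₁c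
  have hG₁ne : aeval (HahnSeries.single (1 : ℚ) (1 : ZMod 2) : HahnSeries ℚ (ZMod 2)) G₁ ≠ 0 := by
    intro h0; apply hG; rw [hGeq, map_mul, h0, mul_zero]
  have hvF : (j : WithTop ℚ) ≤ (HahnSeries.addVal ℚ (ZMod 2)) (aeval (HahnSeries.single (1 : ℚ) (1 : ZMod 2) : HahnSeries ℚ (ZMod 2)) F) := by
    rw [← h, AddValuation.map_mul, hGeq, map_mul, map_pow, aeval_X, AddValuation.map_mul,
      AddValuation.map_pow, v_T, hvG₁, add_zero]
    have : (j : WithTop ℚ) = j • (1 : WithTop ℚ) := by simp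
    rw [this]
    exact le_add_of_nonneg_left hz
  obtain ⟨F₁, hF⟩ := X_pow_dvd_of_le_val j F hvF
  refine ⟨F₁, G₁, hvG₁, hG₁ne, ?_⟩
  have key : (HahnSeries.single (1 : ℚ) (1 : ZMod 2) : HahnSeries ℚ (ZMod 2)) ^ j * (z * aeval (HahnSeries.single (1 : ℚ) (1 : ZMod 2) : HahnSeries ℚ (ZMod 2)) G₁) = (HahnSeries.single (1 : ℚ) (1 : ZMod 2) : HahnSeries ℚ (ZMod 2)) ^ j * aeval (HahnSeries.single (1 : ℚ) (1 : ZMod 2) : HahnSeries ℚ (ZMod 2)) F₁ := by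
    have := h
    rw [hGeq, hF, map_mul, map_mul, map_pow, aeval_X] at this
    calc (HahnSeries.single (1 : ℚ) (1 : ZMod 2) : HahnSeries ℚ (ZMod 2)) ^ j * (z * aeval (HahnSeries.single (1 : ℚ) (1 : ZMod 2) : HahnSeries ℚ (ZMod 2)) G₁) = z * ((HahnSeries.single (1 : ℚ) (1 : ZMod 2) : HahnSeries ℚ (ZMod 2)) ^ j * aeval (HahnSeries.single (1 : ℚ) (1 : ZMod 2) : HahnSeries ℚ (ZMod 2)) G₁) := by ring
      _ = (HahnSeries.single (1 : ℚ) (1 : ZMod 2) : HahnSeries ℚ (ZMod 2)) ^ j * aeval (HahnSeries.single (1 : ℚ) (1 : ZMod 2) : HahnSeries ℚ (ZMod 2)) F₁ := this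
  exact mul_left_cancel₀ (pow_ne_zero j T_ne_zero) key

/-- The `p`-th-root tower (Frobenius): every element of `𝔽₂(t^{1/2^∞})` has a `2^E`-th power in
`𝔽₂(t)`, in the form `y^(2^E) · G(t) = F(t)`. [folklore] -/
theorem rep {y : (HahnSeries ℚ (ZMod 2))}
    (hy : y ∈ IntermediateField.adjoin (ZMod 2)
      (Set.range fun e : ℕ => HahnSeries.single ((1 : ℚ) / 2 ^ e) (1 : ZMod 2))) :
    ∃ (E : ℕ) (F G : (ZMod 2)[X]), aeval (HahnSeries.single (1 : ℚ) (1 : ZMod 2) : HahnSeries ℚ (ZMod 2)) G ≠ 0 ∧ y ^ (2 ^ E) * aeval (HahnSeries.single (1 : ℚ) (1 : ZMod 2) : HahnSeries ℚ (ZMod 2)) G = aeval (HahnSeries.single (1 : ℚ) (1 : ZMod 2) : HahnSeries ℚ (ZMod 2)) F := by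
  induction hy using IntermediateField.adjoin_induction with
  | mem x hx =>
    obtain ⟨e, rfl⟩ := hx
    refine ⟨e, X, 1, by simp, ?_⟩
    have hq : (2 ^ e : ℕ) • ((1 : ℚ) / 2 ^ e) = 1 := by
      rw [nsmul_eq_mul]; push_cast; field_simp
    rw [HahnSeries.single_pow, map_one, mul_one, aeval_X, one_pow, hq]
  | algebraMap c =>
    refine ⟨0, C c, 1, by simp, ?_⟩
    simp [Algebra.algebraMap_eq_smul_one]
  | add x y _ _ ihx ihy =>
    obtain ⟨E₁, F₁, G₁, hG₁, h₁⟩ := ihx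
    obtain ⟨E₂, F₂, G₂, hG₂, h₂⟩ := ihy
    refine ⟨E₁ + E₂, F₁ ^ 2 ^ E₂ * G₂ ^ 2 ^ E₁ + F₂ ^ 2 ^ E₁ * G₁ ^ 2 ^ E₂,
      G₁ ^ 2 ^ E₂ * G₂ ^ 2 ^ E₁, ?_, ?_⟩
    · rw [map_mul, map_pow, map_pow]; exact mul_ne_zero (pow_ne_zero _ hG₁) (pow_ne_zero _ hG₂)
    have h₁' : x ^ 2 ^ (E₁ + E₂) * aeval (HahnSeries.single (1 : ℚ) (1 : ZMod 2) : HahnSeries ℚ (ZMod 2)) (G₁ ^ 2 ^ E₂) = aeval (HahnSeries.single (1 : ℚ) (1 : ZMod 2) : HahnSeries ℚ (ZMod 2)) (F₁ ^ 2 ^ E₂) := by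
      rw [map_pow, map_pow, pow_add, pow_mul, ← mul_pow, h₁]
    have h₂' : y ^ 2 ^ (E₁ + E₂) * aeval (HahnSeries.single (1 : ℚ) (1 : ZMod 2) : HahnSeries ℚ (ZMod 2)) (G₂ ^ 2 ^ E₁) = aeval (HahnSeries.single (1 : ℚ) (1 : ZMod 2) : HahnSeries ℚ (ZMod 2)) (F₂ ^ 2 ^ E₁) := by
      rw [map_pow, map_pow, pow_add, mul_comm (2 ^ E₁) (2 ^ E₂), pow_mul, ← mul_pow, h₂]
    haveI : CharP (HahnSeries ℚ (ZMod 2)) 2 :=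
      charP_of_injective_algebraMap (algebraMap (ZMod 2) (HahnSeries ℚ (ZMod 2))).injective 2
    rw [add_pow_char_pow, map_mul, map_add, map_mul, map_mul]
    linear_combination aeval (HahnSeries.single (1 : ℚ) (1 : ZMod 2) : HahnSeries ℚ (ZMod 2)) (G₂ ^ 2 ^ E₁) * h₁' + aeval (HahnSeries.single (1 : ℚ) (1 : ZMod 2) : HahnSeries ℚ (ZMod 2)) (G₁ ^ 2 ^ E₂) * h₂'
  | inv x _ ih =>
    obtain ⟨E, F, G, hG, h⟩ := ih
    by_cases hx : x = 0
    · subst hx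
      exact ⟨0, 0, 1, by simp, by simp⟩
    have hF : aeval (HahnSeries.single (1 : ℚ) (1 : ZMod 2) : HahnSeries ℚ (ZMod 2)) F ≠ 0 := by
      rw [← h]; exact mul_ne_zero (pow_ne_zero _ hx) hG
    refine ⟨E, G, F, hF, ?_⟩
    rw [inv_pow, ← h, inv_mul_cancel_left₀ (pow_ne_zero _ hx)]
  | mul x y _ _ ihx ihy =>
    obtain ⟨E₁, F₁, G₁, hG₁, h₁⟩ := ihx
    obtain ⟨E₂, F₂, G₂, hG₂, h₂⟩ := ihy
    refine ⟨E₁ + E₂, F₁ ^ 2 ^ E₂ * F₂ ^ 2 ^ E₁, G₁ ^ 2 ^ E₂ * G₂ ^ 2 ^ E₁, ?_, ?_⟩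
    · rw [map_mul, map_pow, map_pow]; exact mul_ne_zero (pow_ne_zero _ hG₁) (pow_ne_zero _ hG₂)
    have h₁' : x ^ 2 ^ (E₁ + E₂) * aeval (HahnSeries.single (1 : ℚ) (1 : ZMod 2) : HahnSeries ℚ (ZMod 2)) (G₁ ^ 2 ^ E₂) = aeval (HahnSeries.single (1 : ℚ) (1 : ZMod 2) : HahnSeries ℚ (ZMod 2)) (F₁ ^ 2 ^ E₂) := by
      rw [map_pow, map_pow, pow_add, pow_mul, ← mul_pow, h₁]
    have h₂' : y ^ 2 ^ (E₁ + E₂) * aeval (HahnSeries.single (1 : ℚ) (1 : ZMod 2) : HahnSeries ℚ (ZMod 2)) (G₂ ^ 2 ^ E₁) = aeval (HahnSeries.single (1 : ℚ) (1 : ZMod 2) : HahnSeries ℚ (ZMod 2)) (F₂ ^ 2 ^ E₁) := by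
      rw [map_pow, map_pow, pow_add, mul_comm (2 ^ E₁) (2 ^ E₂), pow_mul, ← mul_pow, h₂]
    rw [mul_pow, map_mul, map_mul]
    linear_combination (y ^ 2 ^ (E₁ + E₂) * aeval (HahnSeries.single (1 : ℚ) (1 : ZMod 2) : HahnSeries ℚ (ZMod 2)) (G₂ ^ 2 ^ E₁)) * h₁' + aeval (HahnSeries.single (1 : ℚ) (1 : ZMod 2) : HahnSeries ℚ (ZMod 2)) (F₁ ^ 2 ^ E₂) * h₂'

end Summit.ResolutionOfSingularities.ResolutionOfSingularities.Theorems.StrictDrop.Negative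

end
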